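import Summits.ResolutionOfSingularities.ResolutionOfSingularities.Theorems.EquisingularLiftEquisingularLiftNatAnnIdealSheaf
import Literature.AlgebraicGeometry.FormalGeometry.WittGEUnitBoundStepII
import Literature.AlgebraicGeometry.Morphisms.FormalModuleHomCoh
import Literature.AlgebraicGeometry.Morphisms.FormalModuleAffine
import Literature.AlgebraicGeometry.Morphisms.FormalModulePowerTorsion
import Literature.AlgebraicGeometry.Morphisms.FormalModuleCompletionCokernel
import Literature.AlgebraicGeometry.Modules.IdealMul
import HarnessLib

/-!
# [OURS · L1 W4.5(b) · EL♮(3) · F-88♭ brick 2] Grothendieck's existence theorem for CLOSED FORMAL SUBSCHEMES along a PRINCIPAL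
# ideal, ideal-sheaf form: a system of quasi-coherent ideals `K_n ⊆ 𝒪_X` with `K_n = K_{n+1} + (α)ⁿ⁺¹` on `X` proper over a
# noetherian `a`-adically complete `A` (`α = f♯a`) is `K_n = K + (α)ⁿ⁺¹` for ONE quasi-coherent ideal `K`

Crux chain w45b (cell `res-hironaka`, slot W4.5(b)), working crux **EL♮** = stmt-ResolutionOfSingularities-20038, child **EL♮(3)** =
stmt-ResolutionOfSingularities-20148, route EquisingularLift, line `sections`. Written by res-type-027 g23 as brick 2 (the module-side CORE)
of **F-88♭** = the principal-ideal case of the registered NEED-FACT stub `stub_elnat_grothendieckExistence :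
Literature.AlgebraicGeometry.FormalGeometry.GrothendieckExistence.{0}` (F-88, Görtz–Wedhorn II Prop. 24.109 / EGA III₁ Cor. 5.1.8) AS A THEOREM
(INPUTS ADDENDUM 8 §2 option (A); res-inputs-crit-1 R176 «THEOREM only, never a new Prop» / R186). The crux consumes F-88 at ONE kernel
site (`embeddedLiftFact_of_infinitesimal_of_grothendieckExistence`, p598091) with `A := O` a complete DVR and `I := 𝔪_O = (ϖ)` PRINCIPAL, so
the principal case suffices for the door. HONEST FRAMING: OURS glue around PUBLISHED theorems that are ALREADY KERNEL THEOREMS in the tree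
(GW II Thm. 24.94 / Lemma 24.103–24.105 along one global function: `GrothendieckExistenceProper.exists_coh_iso_cmplTower_of_isProper`,
`FormalGeometry/WittGEUnitBoundStepII`; GW II Cor. 24.100: `Morphisms/FormalModuleHomCoh.existsUnique_cmplMap_coh`,
`cmplMap_injective_coh`); nothing of H. Hironaka's 2017 manuscript is involved or attributed; AI-written, gate-checked, weaker than expert
review. No `sorry`; standard axioms; DEF-FREE apart from the transparent abbreviations `powIdeal`/`quotMod` and the auxiliary data
`transMap`/`β`/`tower` (constructions, not `Prop`s). `--supports stmt-ResolutionOfSingularities-20148 --as helper`.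

RESULT `GEPrincipal.exists_idealSheaf_forall_eq_sup`: `A` noetherian, `a ∈ A`, `A` `(a)`-adically complete, `f : X ⟶ Spec A` proper,
`α := algebraMapΓ f a ∈ Γ(X, 𝒪_X)`; `K : ℕ → X.IdealSheafData` with `K n = K (n+1) ⊔ (α)ⁿ⁺¹` for all `n` (`powIdeal α n =
ofIdealTop (span {α}) ^ (n+1)`) ⟹ `∃ K', ∀ n, K n = K' ⊔ (α)ⁿ⁺¹`. In words: a compatible system of closed subschemes
`V(K_n) ⊆ V(αⁿ⁺¹)`, `V(K_n) = V(K_{n+1}) ∩ V(αⁿ⁺¹)` — a closed formal subscheme of the completion `X_{/V(α)}` — is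
`V(K') ∩ V(αⁿ⁺¹)` for one closed subscheme `V(K')` of `X` (GW II Prop. 24.109, the case treated in its proof p. 577 L10–11 /
EGA III₁ 5.1.8, for the ideal of definition `𝔍 = (a)`). The scheme-language form with Mathlib's `infinitesimalNeighbourhood`
thickenings and cartesian squares (= F-88's binders with `I := Ideal.span {a}`) is brick 3 (`…NatGEPrincipalThickenings`).

PROOF (EGA III₁ 5.1.8's seven lines, executed). (1) `M_n := 𝒪_X/K_n` is coherent, killed by `αⁿ⁺¹`, and
`M_{n+1}/αⁿ⁺¹M_{n+1} ≅ M_n` (`β`: both are `𝒪_X` modulo `K_{n+1} + (α)ⁿ⁺¹ = K_n`), so `(M_n)_n` is a coherent formal tower along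
`α` (`IsFormalTower.ofIsos`). (2) Grothendieck existence for the proper `X`: `(F/αⁿ⁺¹F)_n ≅ (M_n)_n` for a coherent `F`. (3) Full
faithfulness: the quotient maps `(𝒪_X/αⁿ⁺¹)_n → (M_n)_n ≅ (F/αⁿ⁺¹F)_n` (`exists_towerHom_of_compatible'`) are `cmplMap v` for a
`v : 𝒪_X → F`, so `𝒪_X → 𝒪_X/K_n` factors as `v ≫ (F → F/αⁿ⁺¹F) ≫ e_n`. (4) Nakayama via faithfulness (`epi_of_epi_cmplMapApp`):
the cokernel `Q` of `v` has `Q/αⁿ⁺¹Q = 0`, so `cmplMap (𝟙 Q) = cmplMap 0`, `𝟙 Q = 0`, `v` is onto. (5) Levels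
(`K_eq_annIdeal_sup`): `K' := Ann(v(1))` (brick 1; `= ker v`); on an affine `V`, `r ∈ K_n(V)` iff `v(r)` dies in `Γ(V, F/αⁿ⁺¹F)`
iff `v(r) = αⁿ⁺¹ v(w)` (right exactness of affine sections; `v` onto on affine sections) iff `r ∈ K'(V) + αⁿ⁺¹Γ(V, 𝒪_X)`.
References (method / index only): EGA III₁ (1961) 5.1.4/5.1.8; Görtz–Wedhorn II (2023) 24.94, 24.100, 24.103, 24.109; Stacks 087W, 088C.
-/

set_option linter.dupNamespace false -- mandated namespace `Summit.<Summit>.<Problem>` of this single-conjunct summit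

noncomputable section

-- `TopCat.Presheaf`/`Scheme.Modules` are not reducible (as in Mathlib's `AlgebraicGeometry/Modules`).
set_option backward.isDefEq.respectTransparency false

open CategoryTheory CategoryTheory.Limits AlgebraicGeometry TopologicalSpace Opposite
open Literature.AlgebraicGeometry.Modules Literature.AlgebraicGeometry.Morphisms
open Literature.AlgebraicGeometry.FormalGeometry.WittGrothendieckExistence

universe u

namespace Summit.ResolutionOfSingularities.ResolutionOfSingularities.Cruxes.EquisingularLiftNat.Sections

namespace GEPrincipal

variable {X : Scheme.{u}}

/-! ### The ideal sheaves `(α)ⁿ⁺¹` -/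

/-- The ideal sheaf `(α)ⁿ⁺¹ ⊆ 𝒪_X` of a global function `α` (Mathlib `IdealSheafData.ofIdealTop`). [folklore] -/
abbrev powIdeal (α : Γ(X, ⊤)) (n : ℕ) : X.IdealSheafData :=
  Scheme.IdealSheafData.ofIdealTop (Ideal.span {α}) ^ (n + 1)

/-- On an affine open `V`, `(α)ⁿ⁺¹(V)` is generated by `αⁿ⁺¹|_V`. [folklore] -/
theorem powIdeal_ideal (α : Γ(X, ⊤)) (n : ℕ) (V : X.affineOpens) :
    (powIdeal α n).ideal V =
      Ideal.span {X.presheaf.map (homOfLE (le_top : (V : X.Opens) ≤ ⊤)).op α ^ (n + 1)} := by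
  rw [Scheme.IdealSheafData.ideal_pow, Pi.pow_apply, Scheme.IdealSheafData.ofIdealTop_ideal,
    Ideal.map_span, Set.image_singleton, Ideal.span_singleton_pow]

/-! ### The quotient tower `(𝒪_X/K_n)_n` of a compatible system of ideals -/

section Tower

variable (α : Γ(X, ⊤)) (K : ℕ → X.IdealSheafData) (hK : ∀ n, K n = K (n + 1) ⊔ powIdeal α n)

/-- `𝒪_X/K_n` as an `𝒪_X`-module. [folklore] -/
abbrev quotMod (n : ℕ) : X.Modules := idealQuot (unitModule X) (K n)

include hK in
/-- `K_{n+1} ≤ K_n`. [folklore] -/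
theorem K_succ_le (n : ℕ) : K (n + 1) ≤ K n := by
  rw [hK n]; exact le_sup_left

include hK in
/-- `(α)ⁿ⁺¹ ≤ K_n`. [folklore] -/
theorem powIdeal_le (n : ℕ) : powIdeal α n ≤ K n := by
  rw [hK n]; exact le_sup_right

include hK in
/-- `αⁿ⁺¹` kills `𝒪_X/K_n`. [folklore] -/
theorem globalScalar_quotMod_eq_zero (n : ℕ) : globalScalar (quotMod K n) (α ^ (n + 1)) = 0 :=
  globalScalar_eq_zero_of_isKilledBy_pow_ofIdealTop α
    ((isKilledBy_idealQuot _ (K n)).anti (powIdeal_le α K hK n))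

/-- The transition `𝒪_X/K_{n+1} → 𝒪_X/K_n` (for `K_{n+1} ≤ K_n`). [folklore] -/
def transMap (n : ℕ) (h : K (n + 1) ≤ K n) : quotMod K (n + 1) ⟶ quotMod K n :=
  idealQuotDesc ((isKilledBy_idealQuot (unitModule X) (K n)).anti h) (idealQuotπ _ (K n))

/-- The transition is compatible with the quotient maps. [folklore] -/
@[reassoc (attr := simp)]
theorem idealQuotπ_transMap (n : ℕ) (h : K (n + 1) ≤ K n) :
    idealQuotπ _ (K (n + 1)) ≫ transMap K n h = idealQuotπ _ (K n) :=
  idealQuotπ_desc _ _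

include hK in
/-- `K_n = K_{n+1} + (α)ⁿ⁺¹` kills `(𝒪_X/K_{n+1}) / αⁿ⁺¹`. [folklore] -/
theorem isKilledBy_cokernel (n : ℕ) :
    IsKilledBy (K n) (cokernel (globalScalar (quotMod K (n + 1)) (α ^ (n + 1)))) := by
  rw [hK n]
  exact IsKilledBy.sup ((isKilledBy_idealQuot _ (K (n + 1))).of_epi (cokernel.π _))
    (isKilledBy_pow_ofIdealTop_of_globalScalar_eq_zero α (globalScalar_cmplObj_eq_zero α _ n))

/-- **`(𝒪_X/K_{n+1}) / αⁿ⁺¹ ≅ 𝒪_X/K_n`** when `K_n = K_{n+1} + (α)ⁿ⁺¹`. [folklore] -/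
def β (n : ℕ) : cokernel (globalScalar (quotMod K (n + 1)) (α ^ (n + 1))) ≅ quotMod K n where
  hom := cokernel.desc _ (transMap K n (K_succ_le α K hK n)) (by
    rw [globalScalar_comp, globalScalar_quotMod_eq_zero α K hK n, comp_zero])
  inv := idealQuotDesc (isKilledBy_cokernel α K hK n) (idealQuotπ _ (K (n + 1)) ≫ cokernel.π _)
  hom_inv_id := by
    refine coequalizer.hom_ext ?_
    rw [cokernel.π_desc_assoc, Category.comp_id]
    refine idealQuot_hom_ext ?_
    rw [idealQuotπ_transMap_assoc, idealQuotπ_desc]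
  inv_hom_id := by
    refine idealQuot_hom_ext ?_
    rw [← Category.assoc, idealQuotπ_desc, Category.assoc, cokernel.π_desc, idealQuotπ_transMap,
      Category.comp_id]

/-- `β` is the transition on the cokernel. [folklore] -/
@[reassoc]
theorem cokernel_π_β_hom (n : ℕ) :
    cokernel.π _ ≫ (β α K hK n).hom = transMap K n (K_succ_le α K hK n) :=
  cokernel.π_desc _ _ _

/-- The formal tower `(𝒪_X/K_n)_n` along `α`. [folklore] -/
def tower : ℕᵒᵖ ⥤ X.Modules := towerOfIsos α (quotMod K) (β α K hK)

/-- The levels of the tower are the `𝒪_X/K_n`. [folklore] -/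
theorem tower_obj (n : ℕ) : (tower α K hK).obj ⟨n⟩ = quotMod K n := rfl

/-- **`(𝒪_X/K_n)_n` is a formal tower along `α`** (`aⁿ⁺¹M_n = 0`, `M_n = M_{n+1}/αⁿ⁺¹M_{n+1}`).
[cite: GortzWedhorn2023, Def. 24.85 and (24.18.1) (pp. 561–562)] -/
theorem isFormalTower_tower : IsFormalTower α (tower α K hK) :=
  IsFormalTower.ofIsos α _ _ (globalScalar_quotMod_eq_zero α K hK)

/-- The transition maps of the tower. [folklore] -/
theorem towerπ_tower (n : ℕ) :
    towerπ (tower α K hK) n = cokernel.π _ ≫ (β α K hK n).hom :=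
  towerπ_towerOfIsos α _ _ n

/-- The quotient maps `𝒪_X → 𝒪_X/K_n` are compatible with the transitions of the tower. [folklore] -/
theorem idealQuotπ_towerπ (n : ℕ) :
    (idealQuotπ (unitModule X) (K (n + 1)) : unitModule X ⟶ (tower α K hK).obj ⟨n + 1⟩) ≫
        towerπ (tower α K hK) n = idealQuotπ (unitModule X) (K n) := by
  rw [towerπ_tower, cokernel_π_β_hom, idealQuotπ_transMap]

/-- The levels `𝒪_X/K_n` are coherent (`X` locally noetherian). [folklore] -/
theorem coh_tower [IsLocallyNoetherian X] (n : ℕ) : Coh ((tower α K hK).obj ⟨n⟩) :=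
  coh_idealQuot (K n) ⟨IsAffineLocalizing.unit, IsAffineFiniteType.unit⟩

end Tower

/-! ### Algebraization: `𝒪_X/K_n ≅ F/αⁿ⁺¹F` for a coherent quotient `v : 𝒪_X ↠ F` -/

section Algebraize

variable {A : Type u} [CommRing A] [IsNoetherianRing A] (f : X ⟶ Spec (.of A)) [IsProper f]
  (a : A) [IsAdicComplete (Ideal.span {a}) A]
  (K : ℕ → X.IdealSheafData) (hK : ∀ n, K n = K (n + 1) ⊔ powIdeal (algebraMapΓ f a) n)

/-- The coherent `𝒪_X`. [folklore] -/
theorem coh_unit [IsLocallyNoetherian X] : Coh (unitModule X) :=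
  ⟨IsAffineLocalizing.unit, IsAffineFiniteType.unit⟩

include hK in
/-- **Grothendieck existence applied to the quotient tower**: there are a coherent `F`, a morphism
`v : 𝒪_X ⟶ F` and isomorphisms `e_n : F/αⁿ⁺¹F ≅ 𝒪_X/K_n` with `𝒪_X → 𝒪_X/K_n` = `v ≫ (F → F/αⁿ⁺¹F) ≫ e_n`.
[cite: GortzWedhorn2023, Thm. 24.94 and Cor. 24.100 (pp. 566–568)] -/
theorem exists_coh_hom_isos :
    ∃ (F : X.Modules) (_ : Coh F) (v : unitModule X ⟶ F)
      (e : ∀ n, cmplObj (algebraMapΓ f a) F n ≅ quotMod K n),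
      ∀ n, idealQuotπ (unitModule X) (K n) = v ≫ cmplπ (algebraMapΓ f a) F n ≫ (e n).hom := by
  haveI : IsLocallyNoetherian X := LocallyOfFiniteType.isLocallyNoetherian f
  set α := algebraMapΓ f a with hα
  have hT := isFormalTower_tower α K hK
  obtain ⟨F, hF, ⟨e⟩⟩ :=
    GrothendieckExistenceProper.exists_coh_iso_cmplTower_of_isProper f a hT (coh_tower α K hK)
  -- the quotient maps `𝒪_X/αⁿ⁺¹ → 𝒪_X/K_n` as a morphism of towers
  obtain ⟨q, hq⟩ := exists_towerHom_of_compatible' α hT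
    (L := unitModule X) (fun n => (idealQuotπ (unitModule X) (K n) : unitModule X ⟶ (tower α K hK).obj ⟨n⟩))
    (fun n => idealQuotπ_towerπ α K hK n)
  -- full faithfulness: `q ≫ e⁻¹ = cmplMap v`
  obtain ⟨v, hv, -⟩ := existsUnique_cmplMap_coh f a coh_unit hF (q ≫ e.inv)
  have hq' : q = cmplMap α v ≫ e.hom := by
    rw [hv, Category.assoc, e.inv_hom_id, Category.comp_id]
  refine ⟨F, hF, v, fun n => e.app ⟨n⟩, fun n => ?_⟩
  have h := hq n
  rw [hq', NatTrans.comp_app, cmplMap_app, ← Category.assoc, cmplπ_cmplMapApp, Category.assoc] at h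
  rw [Iso.app_hom]
  exact h.symm

/-- **Nakayama via faithfulness**: a morphism `v : 𝒪_X ⟶ F` (`F` coherent) all of whose reductions
`𝒪_X/αⁿ⁺¹ → F/αⁿ⁺¹F` are epimorphisms is an epimorphism — its cokernel `Q` has `Q/αⁿ⁺¹Q = 0` for all
`n`, so `cmplMap (𝟙 Q) = cmplMap 0`, whence `𝟙 Q = 0` by the faithfulness of completion on coherent
modules over the proper `X`. [cite: GortzWedhorn2023, Cor. 24.100 (p. 568)] -/
theorem epi_of_epi_cmplMapApp {F : X.Modules} (hF : Coh F) (v : unitModule X ⟶ F)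
    (h : ∀ n, Epi (cmplMapApp (algebraMapΓ f a) v n)) : Epi v := by
  haveI : IsLocallyNoetherian X := LocallyOfFiniteType.isLocallyNoetherian f
  set α := algebraMapΓ f a with hα
  have hQ : Coh (cokernel v) := Coh.cokernel v coh_unit hF
  have hzero : ∀ n, cmplMapApp α (cokernel.π v) n = 0 := fun n => by
    rw [← cancel_epi (cmplMapApp α v n), ← cmplMapApp_comp, cokernel.condition, cmplMapApp_zero,
      comp_zero]
  have hπ : ∀ n, cmplπ α (cokernel v) n = 0 := fun n => by
    rw [← cancel_epi (cokernel.π v), ← cmplπ_cmplMapApp, hzero, comp_zero, comp_zero]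
  have hZ : ∀ n, IsZero (cmplObj α (cokernel v) n) := fun n =>
    IsZero.of_epi_eq_zero (cmplπ α (cokernel v) n) (hπ n)
  have hid : cmplMap α (𝟙 (cokernel v)) = cmplMap α 0 := by
    rw [cmplMap_id, cmplMap_zero]
    exact NatTrans.ext (funext fun n => (hZ n.unop).eq_of_src _ _)
  have h1 : 𝟙 (cokernel v) = 0 := cmplMap_injective_coh f a hQ hQ hid
  exact Preadditive.epi_of_isZero_cokernel' _ (cokernelIsCokernel v)
    ((IsZero.iff_id_eq_zero _).mpr h1)

end Algebraize

/-! ### The levels: `K_n = Ann(v) + (α)ⁿ⁺¹` -/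

section Levels

variable {A : Type u} [CommRing A] (f : X ⟶ Spec (.of A)) (a : A) (K : ℕ → X.IdealSheafData)

/-- In `Γ(V, 𝒪_X)` regarded as a module over itself, `J • ⊤ = J`. [folklore] -/
theorem mem_ideal_smul_top_unit_iff (J : X.IdealSheafData) (V : X.affineOpens)
    (s : Γ(unitModule X, V)) :
    s ∈ J.ideal V • (⊤ : Submodule Γ(X, V) Γ(unitModule X, V)) ↔ (s : Γ(X, V)) ∈ J.ideal V := by
  constructor
  · intro hs
    refine Submodule.smul_induction_on (p := fun m => (m : Γ(X, V)) ∈ J.ideal V) hs ?_ ?_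
    · intro r hr m _
      exact Ideal.mul_mem_right (m : Γ(X, V)) _ hr
    · intro x y hx hy
      exact Ideal.add_mem _ hx hy
  · intro hs
    have h1 : (s : Γ(X, V)) • (show Γ(unitModule X, V) from (1 : Γ(X, V))) = s :=
      mul_one (show Γ(X, V) from s)
    rw [← h1]
    exact Submodule.smul_mem_smul hs trivial

/-- `r ∈ K(V)` iff `r` dies in `Γ(V, 𝒪_X/K)` (`V` affine). [folklore] -/
theorem mem_ideal_iff_idealQuotπ_app_eq_zero (J : X.IdealSheafData) (V : X.affineOpens)
    (r : Γ(X, V)) :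
    r ∈ J.ideal V ↔ (idealQuotπ (unitModule X) J).app V (show Γ(unitModule X, V) from r) = 0 := by
  rw [idealQuotπ_app_eq_zero_iff J IsAffineLocalizing.unit V.2, mem_ideal_smul_top_unit_iff]

/-- A morphism `v : 𝒪_X ⟶ F` on sections: `v(r) = r • v(1)|_U`. [folklore] -/
theorem app_eq_smul_resSec {F : X.Modules} (v : unitModule X ⟶ F) (U : X.Opens) (r : Γ(X, U)) :
    v.app U (show Γ(unitModule X, U) from r) =
      r • resSec (v.app ⊤ (show Γ(unitModule X, ⊤) from (1 : Γ(X, ⊤)))) U := by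
  have h1 : (show Γ(unitModule X, U) from r) = r • (show Γ(unitModule X, U) from (1 : Γ(X, U))) :=
    (mul_one r).symm
  conv_lhs => rw [h1]
  rw [Scheme.Modules.Hom.app_smul]
  congr 1
  have h2 : (show Γ(unitModule X, U) from (1 : Γ(X, U))) =
      (unitModule X).presheaf.map (homOfLE (le_top : U ≤ ⊤)).op
        (show Γ(unitModule X, ⊤) from (1 : Γ(X, ⊤))) := by
    change (1 : Γ(X, U)) = X.presheaf.map (homOfLE (le_top : U ≤ ⊤)).op (1 : Γ(X, ⊤))
    rw [map_one]
  rw [h2]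
  exact ConcreteCategory.congr_hom (v.mapPresheaf.naturality (homOfLE (le_top : U ≤ ⊤)).op) _

/-- Sections dying in `F/αⁿ⁺¹F` over an affine open are the multiples of `αⁿ⁺¹` (`F` coherent). [folklore] -/
theorem cmplπ_app_eq_zero_iff [IsLocallyNoetherian X] (α : Γ(X, ⊤)) {F : X.Modules} (hF : Coh F)
    (n : ℕ) (V : X.affineOpens) (y : Γ(F, V)) :
    (cmplπ α F n).app V y = 0 ↔
      ∃ z : Γ(F, V), X.presheaf.map (homOfLE (le_top : (V : X.Opens) ≤ ⊤)).op (α ^ (n + 1)) • z = y := by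
  constructor
  · intro h
    obtain ⟨z, hz⟩ :=
      exists_app_eq_of_app_cokernel_π_eq_zero (globalScalar F (α ^ (n + 1))) hF hF V.2 y h
    exact ⟨z, by rw [← hz, globalScalar_app_apply]⟩
  · rintro ⟨z, rfl⟩
    rw [← globalScalar_app_apply]
    change ((globalScalar F (α ^ (n + 1)) ≫ cokernel.π _).app V) z = 0
    rw [cokernel.condition]
    rfl

/-- Postcomposing with an isomorphism does not change which sections die. [folklore] -/
theorem comp_app_apply_eq_zero_iff {M N P : X.Modules} (φ : M ⟶ N) (e : N ≅ P) (U : X.Opens)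
    (x : Γ(M, U)) : (φ ≫ e.hom).app U x = 0 ↔ φ.app U x = 0 := by
  rw [Scheme.Modules.Hom.comp_app]
  change e.hom.app U (φ.app U x) = 0 ↔ _
  constructor
  · intro h
    have h' := congrArg (e.inv.app U) h
    rw [map_zero, ← CategoryTheory.comp_apply, ← Scheme.Modules.Hom.comp_app, e.hom_inv_id] at h'
    exact h'
  · intro h
    rw [h, map_zero]

variable {f a K}

/-- **The levels of the algebraization**: if `𝒪_X → 𝒪_X/K_n` factors as `v ≫ (F → F/αⁿ⁺¹F) ≫ e_n` with
`v : 𝒪_X ↠ F` an epimorphism onto a coherent `F` and `e_n` an isomorphism, then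
`K_n = Ann(v(1)) + (α)ⁿ⁺¹`. [cite: GortzWedhorn2023, Prop. 24.109, proof (p. 577)] -/
theorem K_eq_annIdeal_sup [IsLocallyNoetherian X] {F : X.Modules} (hF : Coh F)
    (v : unitModule X ⟶ F) [Epi v] (e : ∀ n, cmplObj (algebraMapΓ f a) F n ≅ quotMod K n)
    (he : ∀ n, idealQuotπ (unitModule X) (K n) = v ≫ cmplπ (algebraMapΓ f a) F n ≫ (e n).hom)
    (hKa : ∀ n, powIdeal (algebraMapΓ f a) n ≤ K n) (n : ℕ) :
    K n = annIdeal hF.loc (v.app ⊤ (show Γ(unitModule X, ⊤) from (1 : Γ(X, ⊤)))) ⊔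
      powIdeal (algebraMapΓ f a) n := by
  -- membership in `K_n(V)` ⟺ `v(r)` dies in `F/αⁿ⁺¹F`
  have key : ∀ (V : X.affineOpens) (r : Γ(X, V)),
      r ∈ (K n).ideal V ↔ (cmplπ (algebraMapΓ f a) F n).app V
        (r • resSec (v.app ⊤ (show Γ(unitModule X, ⊤) from (1 : Γ(X, ⊤)))) V) = 0 := by
    intro V r
    rw [mem_ideal_iff_idealQuotπ_app_eq_zero (K n) V r, he n, ← app_eq_smul_resSec v V r,
      ← Category.assoc, comp_app_apply_eq_zero_iff, Scheme.Modules.Hom.comp_app]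
    rfl
  refine Scheme.IdealSheafData.ext (funext fun V => ?_)
  rw [Scheme.IdealSheafData.ideal_sup, Pi.sup_apply]
  apply le_antisymm
  · intro r hr
    rw [key] at hr
    obtain ⟨z, hz⟩ := (cmplπ_app_eq_zero_iff (algebraMapΓ f a) hF n V _).mp hr
    obtain ⟨w, rfl⟩ := app_surjective_of_epi v IsAffineLocalizing.unit hF.loc V.2 z
    set c : Γ(X, V) := X.presheaf.map (homOfLE (le_top : (V : X.Opens) ≤ ⊤)).op
      (algebraMapΓ f a ^ (n + 1)) with hc
    -- `r - αⁿ⁺¹ w ∈ Ann(σ)(V)`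
    have hw : (r - c * (show Γ(X, V) from w)) •
        resSec (v.app ⊤ (show Γ(unitModule X, ⊤) from (1 : Γ(X, ⊤)))) V = 0 := by
      rw [sub_smul, mul_smul, ← app_eq_smul_resSec v V (show Γ(X, V) from w), hz, sub_self]
    have hmem : r - c * (show Γ(X, V) from w) ∈
        (annIdeal hF.loc (v.app ⊤ (show Γ(unitModule X, ⊤) from (1 : Γ(X, ⊤))))).ideal V :=
      (mem_annIdeal_iff hF.loc _ V _).mpr hw
    have hsplit : r = (r - c * (show Γ(X, V) from w)) + c * (show Γ(X, V) from w) := by ring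
    rw [hsplit]
    refine Ideal.add_mem _ (Ideal.mem_sup_left hmem) (Ideal.mem_sup_right ?_)
    rw [powIdeal_ideal, hc, map_pow]
    exact Ideal.mul_mem_right _ _ (Ideal.mem_span_singleton_self _)
  · refine sup_le (fun r hr => ?_) ((Scheme.IdealSheafData.le_def.mp (hKa n)) V)
    rw [key, (mem_annIdeal_iff hF.loc _ V r).mp hr, map_zero]

end Levels

/-! ### The theorem -/

section Main

variable {A : Type u} [CommRing A] [IsNoetherianRing A] (f : X ⟶ Spec (.of A)) [IsProper f]
  (a : A) [IsAdicComplete (Ideal.span {a}) A]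

/-- **Grothendieck's existence theorem for closed subschemes, ideal-sheaf form along a principal ideal**
(Görtz–Wedhorn II Prop. 24.109 (case in its proof) / EGA III₁ Cor. 5.1.8, for `𝔍 = (a)`): let `A` be
noetherian and `a`-adically complete, `f : X → Spec A` proper, `α = f♯(a)`. If quasi-coherent ideal sheaves
`K_n ⊆ 𝒪_X` satisfy `K_n = K_{n+1} + (α)ⁿ⁺¹` for all `n` — i.e. the closed subschemes `V(K_n) ⊆ V(αⁿ⁺¹)` form a
closed formal subscheme of the completion of `X` along `V(α)` — then there is ONE quasi-coherent ideal sheaf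
`K ⊆ 𝒪_X` with `K_n = K + (α)ⁿ⁺¹` for all `n` (`V(K_n) = V(K) ∩ V(αⁿ⁺¹)`). Proof: the quotient tower
`(𝒪_X/K_n)_n` is a coherent formal tower along `α`, hence (`exists_coh_iso_cmplTower_of_isProper`, GW II
Thm. 24.94) the completion of a coherent `F`; by full faithfulness (GW II Cor. 24.100) the quotient maps come from
a `v : 𝒪_X → F`, which is onto (Nakayama via faithfulness); `K = Ann(v(1)) = ker v`.
[cite: GortzWedhorn2023, Prop. 24.109 (p. 577) with Thm. 24.94 (p. 566) and Cor. 24.100 (p. 568)] -/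
theorem exists_idealSheaf_forall_eq_sup (K : ℕ → X.IdealSheafData)
    (hK : ∀ n, K n = K (n + 1) ⊔ powIdeal (algebraMapΓ f a) n) :
    ∃ K' : X.IdealSheafData, ∀ n, K n = K' ⊔ powIdeal (algebraMapΓ f a) n := by
  haveI : IsLocallyNoetherian X := LocallyOfFiniteType.isLocallyNoetherian f
  obtain ⟨F, hF, v, e, he⟩ := exists_coh_hom_isos f a K hK
  haveI : Epi v := by
    refine epi_of_epi_cmplMapApp f a hF v fun n => ?_
    have hfac : cmplπ (algebraMapΓ f a) (unitModule X) n ≫ cmplMapApp (algebraMapΓ f a) v n =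
        idealQuotπ _ (K n) ≫ (e n).inv := by
      rw [cmplπ_cmplMapApp, he n, Category.assoc, Category.assoc, (e n).hom_inv_id, Category.comp_id]
    exact epi_of_epi_fac hfac
  exact ⟨annIdeal hF.loc (v.app ⊤ (show Γ(unitModule X, ⊤) from (1 : Γ(X, ⊤)))),
    fun n => K_eq_annIdeal_sup hF v e he (powIdeal_le _ K hK) n⟩

end Main

end GEPrincipal

end Summit.ResolutionOfSingularities.ResolutionOfSingularities.Cruxes.EquisingularLiftNat.Sections

end
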